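import Summits.QuantumFields.BalabanUV.Beta.GAN24.ThirdJetThreeKernel
import Summits.QuantumFields.BalabanUV.Beta.GAN24.OffDiagSandwichSum
import Summits.QuantumFields.BalabanUV.Beta.GAN24.TaylorRowVSupport

/-!
# `BalabanUV.Beta.GAN24.ThreeKernelRowVBound` — binder row G-an2-4 / (CONV-C), S-slot («E3Shape» ∧ «E3SupRate»), road S3, DIFF row **R3-dV**
# (typer `LEAVES.md` v3.3 PART III § III.R, holder `b2b-balaban-gan24-formalise-leaf-03-g15`, INTENT «ROW-dV*» journal l.5224), part 3
# (generic `d`): THE ROW-V COUNT WITH THREE ABSTRACT KERNEL LEGS — leaf-14-g18's `TaylorRowV.abs_entry_le` (row S3-V, p207330) transplanted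
# from `e3OfS N` (legs hard-wired to `KInv N`) to the three-leg functional `ThirdJetThreeKernel.e3K3 X Y Z` with the five leg blocks as HYPOTHESES

NOT IN PRINT; OUR PROOF ATTEMPT.  HONEST FRAMING (cell contract, verbatim): «discharging `BetaPertH` makes Bałaban's UV stability
UNCONDITIONAL — a real constructive-QFT result; it is NOT the continuum limit and NOT the Clay problem.»  HONEST DEPENDENCY (verbatim):
«continuum YM on T⁴ ⇐ BetaPertH ∧ nine spine estimates (0/9 proved); BetaPertH ⇐ (D1) ∧ (D4) ∧ CAP+tail; G-an2-4 gates asym, D1 and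
NE2/3/4.»  [folklore] assembly BY NAME of: part 2's abstract-leg unit split `ThirdJetThreeKernel.e3K3_VH_unit_split_of`, leaf-14-g18's
OFF-DIAGONAL SANDWICH ENGINE `OffDiagSandwichSum.sum_abs_channel_le_row` ∕ `_col` (legs abstract there already), VH1's ROW-form masses and
supports `TaylorMassVHPush.sum_abs_pushSum_borderInc_inl_inr_le` ∕ `_inr_inl_le` ∕ `pushSum_borderInc_inl_inr_ne_zero`, leaf-14-g18's
`TaylorRowVSupport.count_mul_mass_le` ∕ `radii_div_le` ∕ `prefactor_eq` ∕ `abs_tsum_add_le_of_sum_abs_le`.  The proof text is leaf-14-g18's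
`abs_entry_le` with the legs renamed — credit there; 0 `def`, 0 cite, 0 `def … : Prop`, 0 sorry.  NO estimate on Bałaban's kernels is made here
(the legs are hypotheses); discharges NOTHING of «E3Shape»/«E3SupRate»/(hS, hSall); NOT BetaPertH, NOT continuum, NOT Clay.

## What is proved (generic `d`, `Lc ≥ 1`)
**`abs_entry3_le`** (member `p = m+k+3`, `N = Lc^p`, the border increment of level `m+1` pushed `k+1` times; legs as hypotheses with one
block-`ℓ¹` rate `κ > 0`, AT THIS MEMBER): for kernels `X, Y, Z` whose relevant blocks obey
`|N^{2(d+1)} X(N•x′, w)_{mm}| ≤ CXΦ e^{−κ|x′ − quo_N w|}`, `|N^{d+2} X(N•x′, w)_{mf}| ≤ CXG e^{…}`, `|N^{d+2} Y(u, N•u′)_{fm}| ≤ CY e^{−κ|quo_N u − u′|}`,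
`|N^{d+2} Z(y, N•z′)_{fm}| ≤ CZH e^{−κ|quo_N y − z′|}`, `|N^{2(d+1)} Z(y, N•z′)_{mm}| ≤ CZΦ e^{…}`,
`|N^{2(d+1)}·e3K3 X Y Z N (weight • pushSum (Lc^{m+2}) (Lc^{k+1}) (borderInc d Lc (Lc^{m+1}))) (κ′,u′;x′,z′) (inl α) (inl β)|`
`≤ |cVH|(d+1)³·(CZH·CY·CXΦ + CXG·CY·CZΦ)·((2R_V+1)^{d+1})²·3ℓ²·e^{κ(2R_V+4(d+1))}·Zl_{d+1}(κ/2)·Lc^{−(d+1)}·Lc^{−2} · (Lc⁻¹)^{k+1} · e^{−(κ/2)(|x′−u′|₁+|z′−u′|₁)}`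
(channel 1 = `X_{mm}` row ∕ `Z_{fm}` column; channel 2 = `X_{mf}` row ∕ `Z_{mm}` column; both with the `ℋ`-column of `Y` at the vertex).
At `X = Y = Z = KInv N` (blocks renamed by the tree's pins) this is leaf-14's `abs_entry_le` with `2·CH·CH·CΦ ↦ CZH·CY·CXΦ + CXG·CY·CZΦ`.
READING (the located use, part 4): with part 1 (`DilatedBorderThirdJet`) and part 2's telescoping, row dV's entry difference is
`abs_entry3_le` applied three times — to `(K♮−K, K♮, K♮)`, `(K, K♮−K, K♮)`, `(K, K, K♮−K)` (`K = KInv (Lc^{n+2})`, `K♮` the unit-rescaled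
`Lc`-decimated `KInv (Lc^{n+3})`) — the difference legs carrying the factor `θ^{n+1}` of «(N1-Cauchy)» ∕ (N1′) ∕ `CauchyDecayK`.
-/

noncomputable section

open Finset
open scoped BigOperators
open Literature.MathematicalPhysics.QuantumFieldTheory
open Literature.MathematicalPhysics.QuantumFieldTheory.Balaban1983to89
open Literature.MathematicalPhysics.QuantumFieldTheory.Balaban1983to89.Beta
open LatticeForm (quo)
open B12Sec2to5 (l1 l1_nonneg)
open ExpKernelCalculus (MKer Zl Zl_pos l1_sub_symm)
open OneStepResolventKernel (Fib LocStencil KInv)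
open AveragingHessianKernels (ell)
open BalabanCompositeJets (pushSum borderInc)
open Summit.QuantumFields.BalabanUV.Beta.GAN24.E3UnitSplit (pushSum_borderInc_inl_inl pushSum_borderInc_inr_inr)
open Summit.QuantumFields.BalabanUV.Beta.GAN24.ThirdJetThreeKernel (e3K3 e3K3_inr_left e3K3_inr_right e3K3_VH_unit_split_of)
open Summit.QuantumFields.BalabanUV.Beta.GAN24.TaylorMassVHPush (sum_abs_pushSum_borderInc_inl_inr_le
  sum_abs_pushSum_borderInc_inr_inl_le pushSum_borderInc_inl_inr_ne_zero)
open Summit.QuantumFields.BalabanUV.Beta.GAN24.OffDiagSandwich (const_nonneg_of_dom)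
open Summit.QuantumFields.BalabanUV.Beta.GAN24.OffDiagSandwichSum (sum_abs_channel_le_col sum_abs_channel_le_row)
open Summit.QuantumFields.BalabanUV.Beta.GAN24.TaylorRowVSupport

namespace Summit.QuantumFields.BalabanUV.Beta.GAN24.ThreeKernelRowVBound

variable {d : ℕ} {Lc : ℕ} [NeZero Lc]

variable {κ CXΦ CXG CY CZH CZΦ : ℝ}

/-- **THE ENTRY ESTIMATE OF ROW V WITH THREE ABSTRACT KERNEL LEGS** [folklore] (generic `d`, `Lc ≥ 1`; member `p = m+k+3`, `N = Lc^p`, the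
border increment of level `m+1` pushed `k+1` times).  Hypotheses: the five relevant leg blocks of the row kernel `X` (`mm`, `mf`), the vertex
kernel `Y` (`fm` = its `ℋ`-column) and the column kernel `Z` (`fm`, `mm`) at THIS member, unit-normalised (`N^{2(d+1)}` on `mm`, `N^{d+2}` on
mixed blocks), each decaying on the block scale at one common rate `κ > 0`.  Conclusion: see the module docstring.  The unit split is part 2's
`e3K3_VH_unit_split_of`; the two channels by `OffDiagSandwichSum.sum_abs_channel_le_row` / `_col` with VH1's ROW-form masses and the supports
keyed to the vertex location; the prefactor by `TaylorRowVSupport.prefactor_eq`.  NO cancellation is used (the smallness of a DIFFERENCE leg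
enters only through its constant). -/
theorem abs_entry3_le (hL : 1 ≤ Lc) (hκ : 0 < κ) (X Y Z : MKer (d + 1) (Fib d)) (m k p : ℕ) (hp : p = m + k + 1 + 1 + 1)
    (hXΦ : ∀ (x' w : Fin (d + 1) → ℤ) (α β : Fin (d + 1)),
      |((Lc : ℝ) ^ p) ^ (2 * (d + 1)) * X (((Lc ^ p : ℕ) : ℤ) • x') w (Sum.inr α) (Sum.inr β)| ≤
        CXΦ * Real.exp (-κ * l1 (x' - quo (Lc ^ p) w)))
    (hXG : ∀ (x' w : Fin (d + 1) → ℤ) (α l : Fin (d + 1)),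
      |((Lc : ℝ) ^ p) ^ (d + 2) * X (((Lc ^ p : ℕ) : ℤ) • x') w (Sum.inr α) (Sum.inl l)| ≤
        CXG * Real.exp (-κ * l1 (x' - quo (Lc ^ p) w)))
    (hY : ∀ (k l : Fin (d + 1)) (u u' : Fin (d + 1) → ℤ),
      |((Lc : ℝ) ^ p) ^ (d + 2) * Y u (((Lc ^ p : ℕ) : ℤ) • u') (Sum.inl k) (Sum.inr l)| ≤
        CY * Real.exp (-κ * l1 (quo (Lc ^ p) u - u')))
    (hZH : ∀ (l β : Fin (d + 1)) (y z' : Fin (d + 1) → ℤ),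
      |((Lc : ℝ) ^ p) ^ (d + 2) * Z y (((Lc ^ p : ℕ) : ℤ) • z') (Sum.inl l) (Sum.inr β)| ≤
        CZH * Real.exp (-κ * l1 (quo (Lc ^ p) y - z')))
    (hZΦ : ∀ (l β : Fin (d + 1)) (y z' : Fin (d + 1) → ℤ),
      |((Lc : ℝ) ^ p) ^ (2 * (d + 1)) * Z y (((Lc ^ p : ℕ) : ℤ) • z') (Sum.inr l) (Sum.inr β)| ≤
        CZΦ * Real.exp (-κ * l1 (quo (Lc ^ p) y - z')))
    (cVH : ℝ) (κ' : Fin (d + 1)) (u' x' z' : Fin (d + 1) → ℤ) (α β : Fin (d + 1)) :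
    |((Lc : ℝ) ^ p) ^ (2 * (d + 1)) *
        e3K3 X Y Z (Lc ^ p)
          (fun κ u => (((Lc : ℝ) ^ (d + 1)) ^ (k + 1) * (cVH * ((Lc : ℝ) ^ (m + 1)) ^ (d + 2))) •
            pushSum (Lc ^ (m + 1 + 1)) (Lc ^ (k + 1)) (borderInc d Lc (Lc ^ (m + 1)) κ u)) κ' u' x' z' (Sum.inl α) (Sum.inl β)| ≤
      (|cVH| * ((d : ℝ) + 1) ^ 3 * (CZH * CY * CXΦ + CXG * CY * CZΦ) *
          (((((2 * (2 * (d + 1) * (Lc + 1) + (2 * d + 3)) + 1) ^ (d + 1) : ℕ) : ℝ)) ^ 2 * (3 * (ell (d + 1) Lc : ℝ) ^ 2)) *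
          Real.exp (κ * (2 * ((2 * (d + 1) * (Lc + 1) + (2 * d + 3) : ℕ) : ℝ) + 4 * ((d : ℝ) + 1))) *
          Zl (d + 1) (κ / 2) * (((Lc : ℝ) ^ (d + 1))⁻¹ * ((Lc : ℝ) ^ 2)⁻¹)) *
        ((Lc : ℝ)⁻¹) ^ (k + 1) * Real.exp (-(κ / 2) * (l1 (x' - u') + l1 (z' - u'))) := by
  -- (0) constants and abbreviations
  have hLpos : (0 : ℝ) < Lc := by exact_mod_cast Nat.lt_of_lt_of_le Nat.zero_lt_one hL
  have hCXΦ : 0 ≤ CXΦ := const_nonneg_of_dom (hXΦ 0 0 0 0)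
  have hCXG : 0 ≤ CXG := const_nonneg_of_dom (hXG 0 0 0 0)
  have hCY : 0 ≤ CY := const_nonneg_of_dom (hY 0 0 0 0)
  have hCZH : 0 ≤ CZH := const_nonneg_of_dom (hZH 0 0 0 0)
  have hCZΦ : 0 ≤ CZΦ := const_nonneg_of_dom (hZΦ 0 0 0 0)
  set R : ℕ := 2 * (d + 1) * (Lc + 1) + (2 * d + 3) with hR
  set r₁ : ℕ := R * Lc ^ (m + 1) with hr₁
  set r₂ : ℕ := R * Lc ^ (m + 1) + 2 * (d + 1) * Lc ^ (k + 1) * (Lc ^ (m + 1) * Lc) with hr₂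
  set mT : ℝ := ((Lc ^ (k + 1) : ℕ) : ℝ) * ((((2 * R + 1) ^ (d + 1) : ℕ) : ℝ) *
    ((((Lc ^ (m + 1) : ℕ) : ℝ)) * (3 * (ell (d + 1) Lc : ℝ) ^ 2 / (((Lc ^ (m + 1) : ℕ) : ℝ)) ^ (d + 1)))) with hmT
  -- (1) the unit split
  rw [e3K3_VH_unit_split_of (Lc := Lc) X Y Z _ (fun κ u x z α' β' => pushSum_borderInc_inl_inl κ u x z α' β')
    (fun κ u x z μ ν => pushSum_borderInc_inr_inr κ u x z μ ν) cVH (m + 1) (k + 1) p (by rw [hp]; ring) κ' u' x' z' α β, abs_mul]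
  -- (2) the legs of this member
  have hc : ((((Lc : ℝ) ^ p) ^ (d + 1))⁻¹) = ((((Lc ^ p : ℕ) : ℝ)) ^ (d + 1))⁻¹ := by push_cast; rfl
  have hmass₂ : ∀ (kk : Fin (d + 1)) (u w : Fin (d + 1) → ℤ) (l l' : Fin (d + 1)) (Yf : Finset (Fin (d + 1) → ℤ)),
      ∑ y ∈ Yf, |pushSum (Lc ^ (m + 1 + 1)) (Lc ^ (k + 1)) (borderInc d Lc (Lc ^ (m + 1)) kk u) w y (Sum.inl l) (Sum.inr l')| ≤ mT := by
    intro kk u w l l' Yf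
    have h := sum_abs_pushSum_borderInc_inl_inr_le (Lc ^ (m + 1)) (Lc ^ (k + 1)) hL kk u w l l' Yf
    rw [← pow_succ] at h
    exact h
  have hmass₁ : ∀ (kk : Fin (d + 1)) (u y : Fin (d + 1) → ℤ) (l l' : Fin (d + 1)) (W : Finset (Fin (d + 1) → ℤ)),
      ∑ w ∈ W, |pushSum (Lc ^ (m + 1 + 1)) (Lc ^ (k + 1)) (borderInc d Lc (Lc ^ (m + 1)) kk u) w y (Sum.inr l) (Sum.inl l')| ≤ mT := by
    intro kk u y l l' W
    have h := sum_abs_pushSum_borderInc_inr_inl_le (Lc ^ (m + 1)) (Lc ^ (k + 1)) hL kk u y l l' W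
    rw [← pow_succ] at h
    exact h
  have hr₂cast : (((R * Lc ^ (m + 1) : ℕ) : ℝ)) + 2 * ((d : ℝ) + 1) * ((Lc ^ (k + 1) : ℕ) : ℝ) * ((Lc ^ (m + 1) * Lc : ℕ) : ℝ) =
      ((r₂ : ℕ) : ℝ) := by
    rw [hr₂]; push_cast; ring
  have hsupp₂ : ∀ (kk : Fin (d + 1)) (u w y : Fin (d + 1) → ℤ) (l l' : Fin (d + 1)),
      pushSum (Lc ^ (m + 1 + 1)) (Lc ^ (k + 1)) (borderInc d Lc (Lc ^ (m + 1)) kk u) w y (Sum.inl l) (Sum.inr l') ≠ 0 →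
        l1 (w - u) ≤ r₁ ∧ l1 (y - u) ≤ r₂ := by
    intro kk u w y l l' hne
    have h := pushSum_borderInc_inl_inr_ne_zero (Lc ^ (m + 1)) (Lc ^ (k + 1)) hL (by rw [← pow_succ]; exact hne)
    refine ⟨h.2.1, ?_⟩
    rw [← hr₂cast]; exact h.2.2
  have hsupp₁ : ∀ (kk : Fin (d + 1)) (u w y : Fin (d + 1) → ℤ) (l l' : Fin (d + 1)),
      pushSum (Lc ^ (m + 1 + 1)) (Lc ^ (k + 1)) (borderInc d Lc (Lc ^ (m + 1)) kk u) w y (Sum.inr l) (Sum.inl l') ≠ 0 →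
        l1 (w - u) ≤ r₂ ∧ l1 (y - u) ≤ r₁ := by
    intro kk u w y l l' hne
    have h := pushSum_borderInc_inr_inl_ne_zero (Lc ^ (m + 1)) (Lc ^ (k + 1)) hL (by rw [← pow_succ]; exact hne)
    refine ⟨?_, h.2⟩
    rw [← hr₂cast]; exact h.1
  -- (3) the two channels, partial sums
  set E : ℝ := Real.exp (-(κ / 2) * (l1 (x' - u') + l1 (z' - u'))) with hE
  set Bnd₁ : ℝ := (Fintype.card (Fin (d + 1)) : ℝ) ^ 3 * (CZH * CY * CXΦ * mT) * (2 * r₁ + 1 : ℝ) ^ (d + 1) *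
    Real.exp (κ * (((r₁ : ℝ) + r₂) / ((Lc ^ p : ℕ) : ℝ) + 2 * ((d + 1 : ℕ) : ℝ))) * (Zl (d + 1) (κ / 2) * E) with hBnd₁
  set Bnd₂ : ℝ := (Fintype.card (Fin (d + 1)) : ℝ) ^ 3 * (CXG * CY * CZΦ * mT) * (2 * r₁ + 1 : ℝ) ^ (d + 1) *
    Real.exp (κ * (((r₁ : ℝ) + r₂) / ((Lc ^ p : ℕ) : ℝ) + 2 * ((d + 1 : ℕ) : ℝ))) * (Zl (d + 1) (κ / 2) * E) with hBnd₂
  have h1 : ∀ Yf : Finset (Fin (d + 1) → ℤ), ∑ y ∈ Yf, |∑ l' : Fin (d + 1),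
      (∑' w : Fin (d + 1) → ℤ, ∑ l : Fin (d + 1),
          (((Lc : ℝ) ^ p) ^ (2 * (d + 1)) * X (((Lc ^ p : ℕ) : ℤ) • x') w (Sum.inr α) (Sum.inr l)) *
          ∑ κ'' : Fin (d + 1), (((Lc : ℝ) ^ p) ^ (d + 1))⁻¹ * ∑' u : Fin (d + 1) → ℤ,
            (((Lc : ℝ) ^ p) ^ (d + 2) * Y u (((Lc ^ p : ℕ) : ℤ) • u') (Sum.inl κ'') (Sum.inr κ')) *
              pushSum (Lc ^ (m + 1 + 1)) (Lc ^ (k + 1)) (borderInc d Lc (Lc ^ (m + 1)) κ'' u) w y (Sum.inr l) (Sum.inl l')) *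
        (((Lc : ℝ) ^ p) ^ (d + 2) * Z y (((Lc ^ p : ℕ) : ℤ) • z') (Sum.inl l') (Sum.inr β))| ≤ Bnd₁ := by
    intro Yf
    have h := sum_abs_channel_le_row (ι := Fin (d + 1)) (D := d + 1) (Lc ^ p)
      (fun l w => ((Lc : ℝ) ^ p) ^ (2 * (d + 1)) * X (((Lc ^ p : ℕ) : ℤ) • x') w (Sum.inr α) (Sum.inr l))
      (fun κ'' u => ((Lc : ℝ) ^ p) ^ (d + 2) * Y u (((Lc ^ p : ℕ) : ℤ) • u') (Sum.inl κ'') (Sum.inr κ'))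
      (fun l' y => ((Lc : ℝ) ^ p) ^ (d + 2) * Z y (((Lc ^ p : ℕ) : ℤ) • z') (Sum.inl l') (Sum.inr β))
      (fun κ'' u w y l l' => pushSum (Lc ^ (m + 1 + 1)) (Lc ^ (k + 1)) (borderInc d Lc (Lc ^ (m + 1)) κ'' u) w y (Sum.inr l) (Sum.inl l'))
      ((((Lc : ℝ) ^ p) ^ (d + 1))⁻¹) hc x' u' z' hκ
      (fun l w => by rw [l1_sub_symm]; exact hXΦ x' w α l)
      (fun κ'' u => hY κ'' κ' u u')
      (fun l' y => hZH l' β y z')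
      hmass₁ hsupp₁ Yf
    refine h.trans (le_of_eq ?_)
    rw [hBnd₁, add_comm (l1 (z' - u')) (l1 (x' - u'))]
  have h2 : ∀ Yf : Finset (Fin (d + 1) → ℤ), ∑ y ∈ Yf, |∑ l' : Fin (d + 1),
      (∑' w : Fin (d + 1) → ℤ, ∑ l : Fin (d + 1),
          (((Lc : ℝ) ^ p) ^ (d + 2) * X (((Lc ^ p : ℕ) : ℤ) • x') w (Sum.inr α) (Sum.inl l)) *
          ∑ κ'' : Fin (d + 1), (((Lc : ℝ) ^ p) ^ (d + 1))⁻¹ * ∑' u : Fin (d + 1) → ℤ,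
            (((Lc : ℝ) ^ p) ^ (d + 2) * Y u (((Lc ^ p : ℕ) : ℤ) • u') (Sum.inl κ'') (Sum.inr κ')) *
              pushSum (Lc ^ (m + 1 + 1)) (Lc ^ (k + 1)) (borderInc d Lc (Lc ^ (m + 1)) κ'' u) w y (Sum.inl l) (Sum.inr l')) *
        (((Lc : ℝ) ^ p) ^ (2 * (d + 1)) *
          Z y (((Lc ^ p : ℕ) : ℤ) • z') (Sum.inr l') (Sum.inr β))| ≤ Bnd₂ := by
    intro Yf
    have h := sum_abs_channel_le_col (ι := Fin (d + 1)) (D := d + 1) (Lc ^ p)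
      (fun l w => ((Lc : ℝ) ^ p) ^ (d + 2) * X (((Lc ^ p : ℕ) : ℤ) • x') w (Sum.inr α) (Sum.inl l))
      (fun κ'' u => ((Lc : ℝ) ^ p) ^ (d + 2) * Y u (((Lc ^ p : ℕ) : ℤ) • u') (Sum.inl κ'') (Sum.inr κ'))
      (fun l' y => ((Lc : ℝ) ^ p) ^ (2 * (d + 1)) * Z y (((Lc ^ p : ℕ) : ℤ) • z') (Sum.inr l') (Sum.inr β))
      (fun κ'' u w y l l' => pushSum (Lc ^ (m + 1 + 1)) (Lc ^ (k + 1)) (borderInc d Lc (Lc ^ (m + 1)) κ'' u) w y (Sum.inl l) (Sum.inr l'))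
      ((((Lc : ℝ) ^ p) ^ (d + 1))⁻¹) hc x' u' z' hκ
      (fun l w => by rw [l1_sub_symm]; exact hXG x' w α l)
      (fun κ'' u => hY κ'' κ' u u')
      (fun l' y => hZΦ l' β y z')
      hmass₂ hsupp₂ Yf
    refine h.trans (le_of_eq ?_)
    rw [hBnd₂]
  have hS := abs_tsum_add_le_of_sum_abs_le h1 h2
  -- (4) the constants `Bnd₁ + Bnd₂` against the explicit `L·M`-form
  have hcard : (Fintype.card (Fin (d + 1)) : ℝ) = (d : ℝ) + 1 := by simp
  have hexp : Real.exp (κ * (((r₁ : ℝ) + r₂) / ((Lc ^ p : ℕ) : ℝ) + 2 * ((d + 1 : ℕ) : ℝ))) ≤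
      Real.exp (κ * (2 * (R : ℝ) + 4 * ((d : ℝ) + 1))) := by
    refine Real.exp_le_exp.2 (mul_le_mul_of_nonneg_left ?_ hκ.le)
    have hrad := radii_div_le (d := d) hL R m k
    rw [← hr₁, ← hr₂, ← hp] at hrad
    push_cast at hrad ⊢
    linarith
  have hcm : (2 * (r₁ : ℝ) + 1) ^ (d + 1) * mT ≤
      ((((2 * R + 1) ^ (d + 1) : ℕ) : ℝ)) ^ 2 * (3 * (ell (d + 1) Lc : ℝ) ^ 2) * (Lc : ℝ) ^ (k + 1) * (Lc : ℝ) ^ (m + 1) := by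
    have h := count_mul_mass_le (d := d) hL R (ell (d + 1) Lc : ℝ) m k
    rw [hr₁, hmT]
    exact h
  have hE0 : 0 ≤ E := (Real.exp_pos _).le
  have hZ : 0 ≤ Zl (d + 1) (κ / 2) := (Zl_pos (half_pos hκ)).le
  have hC3 : 0 ≤ CZH * CY * CXΦ + CXG * CY * CZΦ := by positivity
  have hBnd_le : Bnd₁ + Bnd₂ ≤ ((d : ℝ) + 1) ^ 3 * (CZH * CY * CXΦ + CXG * CY * CZΦ) *
      (((((2 * R + 1) ^ (d + 1) : ℕ) : ℝ)) ^ 2 * (3 * (ell (d + 1) Lc : ℝ) ^ 2) * (Lc : ℝ) ^ (k + 1) * (Lc : ℝ) ^ (m + 1)) *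
      Real.exp (κ * (2 * (R : ℝ) + 4 * ((d : ℝ) + 1))) * (Zl (d + 1) (κ / 2) * E) := by
    rw [hBnd₁, hBnd₂, hcard]
    have e1 : ((d : ℝ) + 1) ^ 3 * (CZH * CY * CXΦ * mT) * (2 * (r₁ : ℝ) + 1) ^ (d + 1) *
          Real.exp (κ * (((r₁ : ℝ) + r₂) / ((Lc ^ p : ℕ) : ℝ) + 2 * ((d + 1 : ℕ) : ℝ))) * (Zl (d + 1) (κ / 2) * E) +
        ((d : ℝ) + 1) ^ 3 * (CXG * CY * CZΦ * mT) * (2 * (r₁ : ℝ) + 1) ^ (d + 1) *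
          Real.exp (κ * (((r₁ : ℝ) + r₂) / ((Lc ^ p : ℕ) : ℝ) + 2 * ((d + 1 : ℕ) : ℝ))) * (Zl (d + 1) (κ / 2) * E) =
        ((d : ℝ) + 1) ^ 3 * (CZH * CY * CXΦ + CXG * CY * CZΦ) * ((2 * (r₁ : ℝ) + 1) ^ (d + 1) * mT) *
          Real.exp (κ * (((r₁ : ℝ) + r₂) / ((Lc ^ p : ℕ) : ℝ) + 2 * ((d + 1 : ℕ) : ℝ))) * (Zl (d + 1) (κ / 2) * E) := by ring
    rw [e1]
    have hA0 : 0 ≤ ((d : ℝ) + 1) ^ 3 * (CZH * CY * CXΦ + CXG * CY * CZΦ) := by positivity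
    exact mul_le_mul (mul_le_mul (mul_le_mul_of_nonneg_left hcm hA0) hexp (Real.exp_pos _).le (by positivity)) le_rfl
      (by positivity) (by positivity)
  -- (5) assemble
  have hPF : |-(cVH / (Lc : ℝ) ^ (d + 1)) * ((Lc : ℝ) ^ p) ^ (-(2 : ℤ)) * (Lc : ℝ) ^ (m + 1)| =
      |cVH| * ((Lc : ℝ) ^ (d + 1))⁻¹ * (((Lc : ℝ) ^ p) ^ (-(2 : ℤ)) * (Lc : ℝ) ^ (m + 1)) := by
    rw [abs_mul, abs_mul, abs_neg, abs_div, abs_of_pos (pow_pos hLpos _), abs_of_pos (zpow_pos (pow_pos hLpos _) _),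
      abs_of_pos (pow_pos hLpos _)]
    ring
  have hpre := prefactor_eq (Lc := Lc) hL m k
  rw [← hp] at hpre
  calc |-(cVH / (Lc : ℝ) ^ (d + 1)) * ((Lc : ℝ) ^ p) ^ (-(2 : ℤ)) * (Lc : ℝ) ^ (m + 1)| * _
      ≤ |-(cVH / (Lc : ℝ) ^ (d + 1)) * ((Lc : ℝ) ^ p) ^ (-(2 : ℤ)) * (Lc : ℝ) ^ (m + 1)| * (Bnd₁ + Bnd₂) :=
        mul_le_mul_of_nonneg_left hS (abs_nonneg _)
    _ ≤ |cVH| * ((Lc : ℝ) ^ (d + 1))⁻¹ * (((Lc : ℝ) ^ p) ^ (-(2 : ℤ)) * (Lc : ℝ) ^ (m + 1)) *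
        (((d : ℝ) + 1) ^ 3 * (CZH * CY * CXΦ + CXG * CY * CZΦ) *
          (((((2 * R + 1) ^ (d + 1) : ℕ) : ℝ)) ^ 2 * (3 * (ell (d + 1) Lc : ℝ) ^ 2) * (Lc : ℝ) ^ (k + 1) * (Lc : ℝ) ^ (m + 1)) *
          Real.exp (κ * (2 * (R : ℝ) + 4 * ((d : ℝ) + 1))) * (Zl (d + 1) (κ / 2) * E)) := by
        rw [hPF]
        exact mul_le_mul_of_nonneg_left hBnd_le (by positivity)
    _ = (|cVH| * ((d : ℝ) + 1) ^ 3 * (CZH * CY * CXΦ + CXG * CY * CZΦ) *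
          (((((2 * R + 1) ^ (d + 1) : ℕ) : ℝ)) ^ 2 * (3 * (ell (d + 1) Lc : ℝ) ^ 2)) *
          Real.exp (κ * (2 * (R : ℝ) + 4 * ((d : ℝ) + 1))) *
          Zl (d + 1) (κ / 2) * (((Lc : ℝ) ^ (d + 1))⁻¹ * ((Lc : ℝ) ^ 2)⁻¹)) *
        ((Lc : ℝ)⁻¹) ^ (k + 1) * E := by
        have e2 : ((Lc : ℝ) ^ p) ^ (-(2 : ℤ)) * (Lc : ℝ) ^ (m + 1) * ((Lc : ℝ) ^ (k + 1) * (Lc : ℝ) ^ (m + 1)) =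
            ((Lc : ℝ) ^ 2)⁻¹ * ((Lc : ℝ)⁻¹) ^ (k + 1) := hpre
        calc |cVH| * ((Lc : ℝ) ^ (d + 1))⁻¹ * (((Lc : ℝ) ^ p) ^ (-(2 : ℤ)) * (Lc : ℝ) ^ (m + 1)) *
              (((d : ℝ) + 1) ^ 3 * (CZH * CY * CXΦ + CXG * CY * CZΦ) *
                (((((2 * R + 1) ^ (d + 1) : ℕ) : ℝ)) ^ 2 * (3 * (ell (d + 1) Lc : ℝ) ^ 2) * (Lc : ℝ) ^ (k + 1) * (Lc : ℝ) ^ (m + 1)) *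
                Real.exp (κ * (2 * (R : ℝ) + 4 * ((d : ℝ) + 1))) * (Zl (d + 1) (κ / 2) * E))
            = |cVH| * ((Lc : ℝ) ^ (d + 1))⁻¹ *
              (((Lc : ℝ) ^ p) ^ (-(2 : ℤ)) * (Lc : ℝ) ^ (m + 1) * ((Lc : ℝ) ^ (k + 1) * (Lc : ℝ) ^ (m + 1))) *
              (((d : ℝ) + 1) ^ 3 * (CZH * CY * CXΦ + CXG * CY * CZΦ) *
                (((((2 * R + 1) ^ (d + 1) : ℕ) : ℝ)) ^ 2 * (3 * (ell (d + 1) Lc : ℝ) ^ 2)) *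
                Real.exp (κ * (2 * (R : ℝ) + 4 * ((d : ℝ) + 1))) * (Zl (d + 1) (κ / 2) * E)) := by ring
          _ = _ := by rw [e2]; ring

end Summit.QuantumFields.BalabanUV.Beta.GAN24.ThreeKernelRowVBound

end
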